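import Literature.MathematicalPhysics.KineticTheory.HardSphereWindowPressureStatic
import Mathlib.MeasureTheory.Integral.IntervalIntegral.FundThmCalculus
import Mathlib.MeasureTheory.Integral.DominatedConvergence
import Mathlib.Analysis.Calculus.Deriv.Slope
import Mathlib.Analysis.Complex.Exponential
import HarnessLib

/-!
# Exponential tilts along a hard-sphere flow on the torus: right derivatives of the tilted moments

For a hard-sphere flow `Φ` on `𝕋^d` (`HardSphereFlow (Torus.geometry d) ε N`, Alexander's theorem as a
hypothesis structure), a bounded observable `F` on phase space and a rate `β`, the *tilt* along the orbit
of `z` over the window `[0, u]` is `W_u(z) = exp (β ∫₀ᵘ F (Φ_r z) dr)` — the un-normalised density of the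
self-tilted laws entering Green–Kubo / large-deviation generating functions of time-integrated observables
(Jakšić–Pillet–Rey-Bellet 2011 §§3–5; Dembo–Zeitouni 2010 §2.3). This file records the elementary
regularity IN THE WINDOW `u` of the tilted moments `u ↦ E_μ[X W_u]` against a finite measure `μ` carried
by the good set:

* `HardSphereFlow.hasDerivWithinAt_tilt` — along a good orbit `t ↦ W_t(z)` has RIGHT derivative
  `β F(Φ_u z) W_u(z)` at every `u` for continuous `F` (orbits are right-continuous,
  `IsHardSphereTrajectory.tendsto_nhdsGT`, and FTC-1 from the right);
* `HardSphereFlow.continuous_integral_mul_tilt` — `u ↦ E_μ[X W_u]` is continuous for bounded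
  a.e.-measurable `X`;
* `HardSphereFlow.tendsto_slope_integral_mul_tilt` — its right difference quotients at `u` tend to
  `E_μ[X · βF∘Φ_u · W_u]` (dominated convergence);
* `HardSphereFlow.tendsto_slope_integral_tilt_of_invariant` — if moreover every `Φ_t` preserves `μ`,
  the right difference quotients of `u ↦ E_μ W_u` ALSO tend to `E_μ[βF W_u]` (cocycle
  `∫₀ᵗ = ∫₀^{t-u} + ∫₀ᵘ ∘ Φ_{t-u}` on good orbits and invariance), the identity behind the symmetry
  `E_μ[F∘Φ_u W_u] = E_μ[F W_u]` of self-tilted edge moments.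

## References

* V. Jakšić, C.-A. Pillet, L. Rey-Bellet, *Entropic fluctuations in statistical mechanics: I. Classical
  dynamical systems*, Nonlinearity 24 (2011), arXiv:1009.3248, §§3–5.
* A. Dembo, O. Zeitouni, *Large Deviations Techniques and Applications* (2010), §2.3.
-/

noncomputable section

open MeasureTheory Set Filter Topology

namespace Literature.Analysis.FluidPDE

variable {d : Type*} [Fintype d] {N : ℕ} {ε : ℝ}

/-- Each translation `v ↦ x + proj v` of the torus geometry is continuous (private copy, as in
`HardSphereFlowJointMeasurable`). [folklore] -/
private theorem continuous_translate_torus (x : UnitAddTorus d) :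
    Continuous ((Torus.geometry d).translate x) :=
  (continuous_const.add FunctionSpaces.Torus.continuous_proj :
    Continuous fun v : EuclideanSpace ℝ d => x + FunctionSpaces.Torus.proj v)

/-- The shift `t ↦ t − u` maps right neighbourhoods of `u` onto right neighbourhoods of `0`. [folklore] -/
private theorem tendsto_sub_nhdsGT (u : ℝ) : Tendsto (fun t => t - u) (𝓝[>] u) (𝓝[>] 0) := by
  have h1 : Tendsto (fun t => t - u) (𝓝 u) (𝓝 0) := by
    simpa only [sub_self] using ((continuous_sub_right u).tendsto u)
  refine tendsto_nhdsWithin_iff.2 ⟨h1.mono_left nhdsWithin_le_nhds, ?_⟩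
  filter_upwards [self_mem_nhdsWithin] with t ht using sub_pos.2 (Set.mem_Ioi.1 ht)

/-- A bounded a.e.-measurable real function is integrable against a finite measure. [folklore] -/
private theorem integrable_of_abs_le {α : Type*} [MeasurableSpace α] {μ : Measure α}
    [IsFiniteMeasure μ] {f : α → ℝ} (hf : AEMeasurable f μ) {K : ℝ} (hK : ∀ x, |f x| ≤ K) :
    Integrable f μ :=
  Integrable.of_bound hf.aestronglyMeasurable K (ae_of_all _ fun x => by
    rw [Real.norm_eq_abs]
    exact hK x)

namespace HardSphereFlow

/-! ## Pointwise bounds and measurability of the tilt -/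

/-- `|∫ₐᵇ F(Φ_r z) dr| ≤ |b − a| C` for `|F| ≤ C`, at EVERY point (no integrability needed). [folklore] -/
theorem abs_intervalIntegral_comp_flow_le (Φ : HardSphereFlow (Torus.geometry d) ε N)
    {F : Config N d (UnitAddTorus d) → ℝ} {C : ℝ} (hC : ∀ w, |F w| ≤ C) (a b : ℝ)
    (z : Config N d (UnitAddTorus d)) : |∫ r in a..b, F (Φ.flow r z)| ≤ |b - a| * C := by
  have h := intervalIntegral.norm_integral_le_of_norm_le_const (a := a) (b := b) (C := C)
    (f := fun r => F (Φ.flow r z)) fun r _ => by simpa only [Real.norm_eq_abs] using hC (Φ.flow r z)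
  simpa only [Real.norm_eq_abs, mul_comm C] using h

/-- Two-sided bound on the tilt: `e^{-|β||u|C} ≤ W_u(z) ≤ e^{|β||u|C}`. [folklore] -/
theorem tilt_le (Φ : HardSphereFlow (Torus.geometry d) ε N) {F : Config N d (UnitAddTorus d) → ℝ}
    {C : ℝ} (hC : ∀ w, |F w| ≤ C) (β u : ℝ) (z : Config N d (UnitAddTorus d)) :
    Real.exp (-(|β| * (|u| * C))) ≤ Real.exp (β * ∫ r in (0 : ℝ)..u, F (Φ.flow r z)) ∧
      Real.exp (β * ∫ r in (0 : ℝ)..u, F (Φ.flow r z)) ≤ Real.exp (|β| * (|u| * C)) := by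
  have h1 : |β * ∫ r in (0 : ℝ)..u, F (Φ.flow r z)| ≤ |β| * (|u| * C) := by
    rw [abs_mul]
    refine mul_le_mul_of_nonneg_left ?_ (abs_nonneg _)
    simpa only [sub_zero] using Φ.abs_intervalIntegral_comp_flow_le hC 0 u z
  have h2 := abs_le.1 h1
  exact ⟨Real.exp_le_exp.2 h2.1, Real.exp_le_exp.2 h2.2⟩

/-- The tilt is a.e.-measurable for every measure carried by the good set. [folklore] -/
theorem aemeasurable_tilt (Φ : HardSphereFlow (Torus.geometry d) ε N)
    {μ : Measure (Config N d (UnitAddTorus d))} (hμ : μ Φ.goodᶜ = 0)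
    {F : Config N d (UnitAddTorus d) → ℝ} (hF : Measurable F) (β u : ℝ) :
    AEMeasurable (fun z => Real.exp (β * ∫ r in (0 : ℝ)..u, F (Φ.flow r z))) μ :=
  Real.measurable_exp.comp_aemeasurable
    ((Φ.aemeasurable_intervalIntegral_comp_flow_torus hF 0 u hμ).const_mul β)

/-- Integrability of `X · W_u` for a bounded a.e.-measurable `X` and a finite measure carried by the good
set. [folklore] -/
theorem integrable_mul_tilt (Φ : HardSphereFlow (Torus.geometry d) ε N)
    {μ : Measure (Config N d (UnitAddTorus d))} [IsFiniteMeasure μ] (hμ : μ Φ.goodᶜ = 0)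
    {F : Config N d (UnitAddTorus d) → ℝ} (hF : Measurable F) {C : ℝ} (hC : ∀ w, |F w| ≤ C)
    {X : Config N d (UnitAddTorus d) → ℝ} (hXm : AEMeasurable X μ) {K : ℝ} (hXK : ∀ z, |X z| ≤ K)
    (β u : ℝ) :
    Integrable (fun z => X z * Real.exp (β * ∫ r in (0 : ℝ)..u, F (Φ.flow r z))) μ :=
  integrable_of_abs_le (hXm.mul (Φ.aemeasurable_tilt hμ hF β u)) fun z => by
    rw [abs_mul, abs_of_pos (Real.exp_pos _)]
    exact mul_le_mul (hXK z) (Φ.tilt_le hC β u z).2 (Real.exp_pos _).le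
      ((abs_nonneg _).trans (hXK z))

/-! ## Pathwise: the cocycle and the right derivative of the tilt along good orbits -/

/-- Shifting a time window along a good orbit: `∫ₐᵇ F(Φ_s(Φ_c z)) ds = ∫_{a+c}^{b+c} F(Φ_s z) ds`
(group law `flow_add` on the good set). [folklore] -/
theorem intervalIntegral_comp_flow_flow (Φ : HardSphereFlow (Torus.geometry d) ε N)
    (F : Config N d (UnitAddTorus d) → ℝ) {z : Config N d (UnitAddTorus d)} (hz : z ∈ Φ.good)
    (a b c : ℝ) :
    ∫ s in a..b, F (Φ.flow s (Φ.flow c z)) = ∫ s in (a + c)..(b + c), F (Φ.flow s z) := by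
  have hpt : (fun s => F (Φ.flow s (Φ.flow c z))) = fun s => F (Φ.flow (s + c) z) := by
    funext s
    rw [Φ.flow_add s c z hz]
  rw [hpt, intervalIntegral.integral_comp_add_right (fun s => F (Φ.flow s z)) c]

/-- **Right derivative of the tilt along a good orbit.** For continuous bounded `F` and `z` good,
`r ↦ F(Φ_r z)` is bounded, measurable and right-continuous (`IsHardSphereTrajectory.tendsto_nhdsGT`), so
`t ↦ ∫₀ᵗ F(Φ_r z) dr` has right derivative `F(Φ_u z)` at every `u` (FTC-1 from the right) and
`t ↦ W_t(z)` has right derivative `β F(Φ_u z) W_u(z)`. [folklore] -/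
theorem hasDerivWithinAt_tilt (Φ : HardSphereFlow (Torus.geometry d) ε N)
    {F : Config N d (UnitAddTorus d) → ℝ} (hFc : Continuous F) {C : ℝ} (hC : ∀ w, |F w| ≤ C)
    {z : Config N d (UnitAddTorus d)} (hz : z ∈ Φ.good) (β u : ℝ) :
    HasDerivWithinAt (fun t => Real.exp (β * ∫ r in (0 : ℝ)..t, F (Φ.flow r z)))
      (Real.exp (β * ∫ r in (0 : ℝ)..u, F (Φ.flow r z)) * (β * F (Φ.flow u z))) (Ici u) u := by
  have htraj := Φ.isTrajectory z hz
  have hfm : Measurable fun r => F (Φ.flow r z) := hFc.measurable.comp htraj.measurable_torus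
  have hJ : HasDerivWithinAt (fun t => ∫ r in (0 : ℝ)..t, F (Φ.flow r z)) (F (Φ.flow u z)) (Ici u) u :=
    intervalIntegral.integral_hasDerivWithinAt_right
      (Φ.intervalIntegrable_comp_flow_of_bounded hz hFc.measurable hC 0 u)
      hfm.stronglyMeasurable.stronglyMeasurableAtFilter
      ((hFc.tendsto _).comp (htraj.tendsto_nhdsGT continuous_translate_torus u))
  exact (hJ.const_mul β).exp

/-- Pathwise Lipschitz-type bound: along a good orbit, for `u ≤ t` with `|β|(t − u)C ≤ 1`,
`|W_t(z) − W_u(z)| ≤ W_u(z) · 2|β|(t − u)C` (`∫₀ᵗ = ∫₀ᵘ + ∫ᵤᵗ` and `|eˣ − 1| ≤ 2|x|` for `|x| ≤ 1`).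
[folklore] -/
theorem abs_tilt_sub_tilt_le (Φ : HardSphereFlow (Torus.geometry d) ε N)
    {F : Config N d (UnitAddTorus d) → ℝ} (hFm : Measurable F) {C : ℝ} (hC : ∀ w, |F w| ≤ C)
    {z : Config N d (UnitAddTorus d)} (hz : z ∈ Φ.good) (β : ℝ) {u t : ℝ} (hut : u ≤ t)
    (hsmall : |β| * ((t - u) * C) ≤ 1) :
    |Real.exp (β * ∫ r in (0 : ℝ)..t, F (Φ.flow r z)) - Real.exp (β * ∫ r in (0 : ℝ)..u, F (Φ.flow r z))|
      ≤ Real.exp (β * ∫ r in (0 : ℝ)..u, F (Φ.flow r z)) * (2 * (|β| * ((t - u) * C))) := by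
  have hfi := fun a b => Φ.intervalIntegrable_comp_flow_of_bounded hz hFm hC a b
  have hsplit : ∫ r in (0 : ℝ)..t, F (Φ.flow r z) =
      (∫ r in (0 : ℝ)..u, F (Φ.flow r z)) + ∫ r in u..t, F (Φ.flow r z) :=
    (intervalIntegral.integral_add_adjacent_intervals (hfi 0 u) (hfi u t)).symm
  have hI : |β * ∫ r in u..t, F (Φ.flow r z)| ≤ |β| * ((t - u) * C) := by
    rw [abs_mul]
    refine mul_le_mul_of_nonneg_left ?_ (abs_nonneg β)
    simpa only [abs_of_nonneg (sub_nonneg.2 hut)] using Φ.abs_intervalIntegral_comp_flow_le hC u t z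
  rw [hsplit, mul_add, Real.exp_add, ← mul_sub_one, abs_mul, abs_of_pos (Real.exp_pos _)]
  refine mul_le_mul_of_nonneg_left ?_ (Real.exp_pos _).le
  exact (Real.abs_exp_sub_one_le (hI.trans hsmall)).trans (by linarith)

/-- On the window `t ∈ (u, u + 1/(|β|C + 1))` the smallness condition `|β|(t − u)C ≤ 1` holds. [folklore] -/
private theorem abs_mul_sub_mul_le_one {β C u t : ℝ} (hC0 : 0 ≤ C) (ht : t ∈ Ioo u (u + 1 / (|β| * C + 1))) :
    |β| * ((t - u) * C) ≤ 1 := by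
  have hA : 0 ≤ |β| * C := mul_nonneg (abs_nonneg β) hC0
  rw [show |β| * ((t - u) * C) = |β| * C * (t - u) by ring]
  calc |β| * C * (t - u) ≤ |β| * C * (1 / (|β| * C + 1)) :=
        mul_le_mul_of_nonneg_left (by linarith [ht.2]) hA
    _ ≤ 1 := by
        rw [mul_one_div, div_le_one (by linarith)]
        linarith

/-! ## Averaged: continuity and right difference quotients of the tilted moments -/

/-- **Continuity of the tilted moments** `u ↦ E_μ[X W_u]` for bounded a.e.-measurable `X` and a finite
measure carried by the good set (dominated convergence: `u ↦ W_u(z)` is continuous along good orbits and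
`|X W_u| ≤ K e^{|β||u|C}`). [folklore] -/
theorem continuous_integral_mul_tilt (Φ : HardSphereFlow (Torus.geometry d) ε N)
    {μ : Measure (Config N d (UnitAddTorus d))} [IsFiniteMeasure μ] (hμ : μ Φ.goodᶜ = 0)
    {F : Config N d (UnitAddTorus d) → ℝ} (hFm : Measurable F) {C : ℝ} (hC : ∀ w, |F w| ≤ C)
    (hC0 : 0 ≤ C) {X : Config N d (UnitAddTorus d) → ℝ} (hXm : AEMeasurable X μ) {K : ℝ}
    (hXK : ∀ z, |X z| ≤ K) (β : ℝ) :
    Continuous fun u => ∫ z, X z * Real.exp (β * ∫ r in (0 : ℝ)..u, F (Φ.flow r z)) ∂μ := by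
  refine continuous_iff_continuousAt.2 fun u₀ => ?_
  refine continuousAt_of_dominated (bound := fun _ => K * Real.exp (|β| * ((|u₀| + 1) * C)))
    (Eventually.of_forall fun u => (Φ.integrable_mul_tilt hμ hFm hC hXm hXK β u).aestronglyMeasurable)
    ?_ (integrable_const _) ?_
  · filter_upwards [Metric.ball_mem_nhds u₀ one_pos] with u hu
    refine ae_of_all _ fun z => ?_
    rw [Real.norm_eq_abs, abs_mul, abs_of_pos (Real.exp_pos _)]
    have h1 : |u| - |u₀| ≤ |u - u₀| := abs_sub_abs_le_abs_sub u u₀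
    have h2 : |u - u₀| < 1 := by rwa [← Real.dist_eq]
    refine mul_le_mul (hXK z) ((Φ.tilt_le hC β u z).2.trans ?_) (Real.exp_pos _).le
      ((abs_nonneg _).trans (hXK z))
    exact Real.exp_le_exp.2 (mul_le_mul_of_nonneg_left
      (mul_le_mul_of_nonneg_right (by linarith) hC0) (abs_nonneg β))
  · filter_upwards [(mem_ae_iff.2 hμ : ∀ᵐ z ∂μ, z ∈ Φ.good)] with z hz
    have hJc : Continuous fun u => ∫ r in (0 : ℝ)..u, F (Φ.flow r z) :=
      intervalIntegral.continuous_primitive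
        (fun a b => Φ.intervalIntegrable_comp_flow_of_bounded hz hFm hC a b) 0
    exact (continuous_const.mul (continuous_const.mul hJc).rexp).continuousAt

/-- **Right difference quotients of the tilted moments (forward decomposition).** For bounded
a.e.-measurable `X`, continuous bounded `F` and a finite measure carried by the good set,
`(t − u)⁻¹ (E_μ[X W_t] − E_μ[X W_u]) → E_μ[X · W_u · βF∘Φ_u]` as `t ↓ u` (dominated convergence of the
pathwise right derivatives `hasDerivWithinAt_tilt`, domination by `abs_tilt_sub_tilt_le`). [folklore] -/
theorem tendsto_slope_integral_mul_tilt (Φ : HardSphereFlow (Torus.geometry d) ε N)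
    {μ : Measure (Config N d (UnitAddTorus d))} [IsFiniteMeasure μ] (hμ : μ Φ.goodᶜ = 0)
    {F : Config N d (UnitAddTorus d) → ℝ} (hFc : Continuous F) {C : ℝ} (hC : ∀ w, |F w| ≤ C)
    (hC0 : 0 ≤ C) {X : Config N d (UnitAddTorus d) → ℝ} (hXm : AEMeasurable X μ) {K : ℝ}
    (hXK : ∀ z, |X z| ≤ K) (β u : ℝ) :
    Tendsto (fun t => (t - u)⁻¹ *
        ((∫ z, X z * Real.exp (β * ∫ r in (0 : ℝ)..t, F (Φ.flow r z)) ∂μ) -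
          ∫ z, X z * Real.exp (β * ∫ r in (0 : ℝ)..u, F (Φ.flow r z)) ∂μ))
      (𝓝[>] u) (𝓝 (∫ z, X z * (Real.exp (β * ∫ r in (0 : ℝ)..u, F (Φ.flow r z)) *
        (β * F (Φ.flow u z))) ∂μ)) := by
  have hFm := hFc.measurable
  have hint := fun t => Φ.integrable_mul_tilt hμ hFm hC hXm hXK β t
  have haeW := fun t => Φ.aemeasurable_tilt hμ hFm β t
  have heq : ∀ t, (t - u)⁻¹ *
      ((∫ z, X z * Real.exp (β * ∫ r in (0 : ℝ)..t, F (Φ.flow r z)) ∂μ) -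
        ∫ z, X z * Real.exp (β * ∫ r in (0 : ℝ)..u, F (Φ.flow r z)) ∂μ) =
      ∫ z, X z * ((t - u)⁻¹ * (Real.exp (β * ∫ r in (0 : ℝ)..t, F (Φ.flow r z)) -
        Real.exp (β * ∫ r in (0 : ℝ)..u, F (Φ.flow r z)))) ∂μ := by
    intro t
    rw [← integral_sub (hint t) (hint u), ← integral_const_mul]
    refine integral_congr_ae (ae_of_all _ fun z => ?_)
    ring
  simp_rw [heq]
  have hK0 : 0 ≤ K := (abs_nonneg _).trans (hXK (Classical.arbitrary _))
  have hA : 0 ≤ |β| * C := mul_nonneg (abs_nonneg β) hC0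
  refine tendsto_integral_filter_of_dominated_convergence
    (bound := fun _ => K * (Real.exp (|β| * (|u| * C)) * (2 * (|β| * C))))
    (Eventually.of_forall fun t =>
      (hXm.mul (((haeW t).sub (haeW u)).const_mul _)).aestronglyMeasurable) ?_
    (integrable_const _) ?_
  · have hδ : u < u + 1 / (|β| * C + 1) := by
      have : (0 : ℝ) < 1 / (|β| * C + 1) := by positivity
      linarith
    filter_upwards [Ioo_mem_nhdsGT hδ] with t ht
    filter_upwards [(mem_ae_iff.2 hμ : ∀ᵐ z ∂μ, z ∈ Φ.good)] with z hz
    have htu : 0 < t - u := sub_pos.2 ht.1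
    have hb := Φ.abs_tilt_sub_tilt_le hFm hC hz β ht.1.le (abs_mul_sub_mul_le_one hC0 ht)
    rw [Real.norm_eq_abs, abs_mul, abs_mul, abs_inv, abs_of_pos htu]
    calc |X z| * ((t - u)⁻¹ * |Real.exp (β * ∫ r in (0 : ℝ)..t, F (Φ.flow r z)) -
          Real.exp (β * ∫ r in (0 : ℝ)..u, F (Φ.flow r z))|)
        ≤ K * ((t - u)⁻¹ * (Real.exp (β * ∫ r in (0 : ℝ)..u, F (Φ.flow r z)) *
            (2 * (|β| * ((t - u) * C))))) :=
          mul_le_mul (hXK z) (mul_le_mul_of_nonneg_left hb (inv_nonneg.2 htu.le))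
            (by positivity) hK0
      _ = K * (Real.exp (β * ∫ r in (0 : ℝ)..u, F (Φ.flow r z)) * (2 * (|β| * C))) := by
          field_simp
      _ ≤ K * (Real.exp (|β| * (|u| * C)) * (2 * (|β| * C))) :=
          mul_le_mul_of_nonneg_left (mul_le_mul_of_nonneg_right (Φ.tilt_le hC β u z).2
            (mul_nonneg zero_le_two hA)) hK0
  · filter_upwards [(mem_ae_iff.2 hμ : ∀ᵐ z ∂μ, z ∈ Φ.good)] with z hz
    have hs := (hasDerivWithinAt_iff_tendsto_slope' (lt_irrefl u : u ∉ Ioi u)).1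
      (hasDerivWithinAt_Ioi_iff_Ici.2 (Φ.hasDerivWithinAt_tilt hFc hC hz β u))
    refine (hs.const_mul (X z)).congr fun t => ?_
    simp only [slope_def_field, div_eq_inv_mul]

/-- **Right difference quotients of the tilt normalisation (backward decomposition; uses invariance).**
If every `Φ_t` preserves the finite measure `μ` carried by the good set, then for continuous bounded `F`
`(t − u)⁻¹ (E_μ W_t − E_μ W_u) → E_μ[βF W_u]` as `t ↓ u`: on good orbits
`W_t = W_{t−u} · W_u∘Φ_{t−u}` (cocycle) and `E_μ[W_u∘Φ_{t−u}] = E_μ W_u` (invariance), so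
`E_μ W_t − E_μ W_u = E_μ[(W_{t−u} − 1) W_u∘Φ_{t−u}]`, and `(W_δ − 1)/δ → βF` (right derivative at `0`),
`W_u∘Φ_δ = exp β(∫₀^{u+δ} − ∫₀^δ) → W_u` (continuity of the primitive), dominatedly. [folklore] -/
theorem tendsto_slope_integral_tilt_of_invariant (Φ : HardSphereFlow (Torus.geometry d) ε N)
    {μ : Measure (Config N d (UnitAddTorus d))} [IsFiniteMeasure μ] (hμ : μ Φ.goodᶜ = 0)
    (hinv : ∀ t, MeasurePreserving (Φ.flow t) μ μ)
    {F : Config N d (UnitAddTorus d) → ℝ} (hFc : Continuous F) {C : ℝ} (hC : ∀ w, |F w| ≤ C)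
    (hC0 : 0 ≤ C) (β u : ℝ) :
    Tendsto (fun t => (t - u)⁻¹ *
        ((∫ z, Real.exp (β * ∫ r in (0 : ℝ)..t, F (Φ.flow r z)) ∂μ) -
          ∫ z, Real.exp (β * ∫ r in (0 : ℝ)..u, F (Φ.flow r z)) ∂μ))
      (𝓝[>] u) (𝓝 (∫ z, β * F z * Real.exp (β * ∫ r in (0 : ℝ)..u, F (Φ.flow r z)) ∂μ)) := by
  have hFm := hFc.measurable
  have hae : ∀ᵐ z ∂μ, z ∈ Φ.good := mem_ae_iff.2 hμ
  -- abbreviation of the tilt (a genuine function, to keep the statements readable)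
  obtain ⟨W, hW⟩ : ∃ W : ℝ → Config N d (UnitAddTorus d) → ℝ,
      ∀ s z, W s z = Real.exp (β * ∫ r in (0 : ℝ)..s, F (Φ.flow r z)) := ⟨_, fun _ _ => rfl⟩
  have hWfun : ∀ s, (fun z => Real.exp (β * ∫ r in (0 : ℝ)..s, F (Φ.flow r z))) = W s :=
    fun s => funext fun z => (hW s z).symm
  simp only [← hW]
  have hWpos : ∀ s z, 0 < W s z := fun s z => by rw [hW]; exact Real.exp_pos _
  have hWle : ∀ s z, W s z ≤ Real.exp (|β| * (|s| * C)) := fun s z => by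
    rw [hW]; exact (Φ.tilt_le hC β s z).2
  have haeW : ∀ s, AEMeasurable (W s) μ := fun s => by
    rw [← hWfun]; exact Φ.aemeasurable_tilt hμ hFm β s
  have haeWc : ∀ s, AEMeasurable (fun z => W u (Φ.flow s z)) μ := fun s =>
    (haeW u).comp_quasiMeasurePreserving (hinv s).quasiMeasurePreserving
  -- the cocycle on good orbits
  have hcoc : ∀ t, ∀ z ∈ Φ.good, W t z = W (t - u) z * W u (Φ.flow (t - u) z) := by
    intro t z hz
    have hfi := fun a b => Φ.intervalIntegrable_comp_flow_of_bounded hz hFm hC a b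
    have h1 := Φ.intervalIntegral_comp_flow_flow F hz 0 u (t - u)
    rw [zero_add, add_comm, sub_add_cancel] at h1
    rw [hW, hW, hW, h1, ← Real.exp_add, ← mul_add,
      intervalIntegral.integral_add_adjacent_intervals (hfi 0 (t - u)) (hfi (t - u) t)]
  -- invariance
  have hinvZ : ∀ s, ∫ z, W u (Φ.flow s z) ∂μ = ∫ z, W u z ∂μ := by
    intro s
    have h := integral_map (hinv s).measurable.aemeasurable (f := W u)
      (by rw [(hinv s).map_eq]; exact (haeW u).aestronglyMeasurable)
    rw [(hinv s).map_eq] at h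
    exact h.symm
  have hint1 : ∀ t, Integrable (fun z => W (t - u) z * W u (Φ.flow (t - u) z)) μ := fun t =>
    integrable_of_abs_le ((haeW _).mul (haeWc _)) fun z => by
      rw [abs_mul, abs_of_pos (hWpos _ _), abs_of_pos (hWpos _ _)]
      exact mul_le_mul (hWle _ _) (hWle _ _) (hWpos _ _).le (Real.exp_pos _).le
  have hint2 : ∀ s, Integrable (fun z => W u (Φ.flow s z)) μ := fun s =>
    integrable_of_abs_le (haeWc s) fun z => by
      rw [abs_of_pos (hWpos _ _)]
      exact hWle _ _
  have heq : ∀ t, (t - u)⁻¹ * ((∫ z, W t z ∂μ) - ∫ z, W u z ∂μ) =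
      ∫ z, (t - u)⁻¹ * (W (t - u) z - 1) * W u (Φ.flow (t - u) z) ∂μ := by
    intro t
    have h1 : ∫ z, W t z ∂μ = ∫ z, W (t - u) z * W u (Φ.flow (t - u) z) ∂μ :=
      integral_congr_ae (hae.mono fun z hz => hcoc t z hz)
    rw [h1, ← hinvZ (t - u), ← integral_sub (hint1 t) (hint2 (t - u)), ← integral_const_mul]
    refine integral_congr_ae (ae_of_all _ fun z => ?_)
    ring
  simp_rw [heq]
  have hA : 0 ≤ |β| * C := mul_nonneg (abs_nonneg β) hC0
  refine tendsto_integral_filter_of_dominated_convergence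
    (bound := fun _ => 2 * (|β| * C) * Real.exp (|β| * (|u| * C)))
    (Eventually.of_forall fun t =>
      ((((haeW _).sub aemeasurable_const).const_mul _).mul (haeWc _)).aestronglyMeasurable) ?_
    (integrable_const _) ?_
  · have hδ : u < u + 1 / (|β| * C + 1) := by
      have : (0 : ℝ) < 1 / (|β| * C + 1) := by positivity
      linarith
    filter_upwards [Ioo_mem_nhdsGT hδ] with t ht
    refine ae_of_all _ fun z => ?_
    have htu : 0 < t - u := sub_pos.2 ht.1
    have hJ : |β * ∫ r in (0 : ℝ)..(t - u), F (Φ.flow r z)| ≤ |β| * ((t - u) * C) := by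
      rw [abs_mul]
      refine mul_le_mul_of_nonneg_left ?_ (abs_nonneg β)
      simpa only [sub_zero, abs_of_pos htu] using Φ.abs_intervalIntegral_comp_flow_le hC 0 (t - u) z
    have h1 : |W (t - u) z - 1| ≤ 2 * (|β| * ((t - u) * C)) := by
      rw [hW]
      exact (Real.abs_exp_sub_one_le (hJ.trans (abs_mul_sub_mul_le_one hC0 ht))).trans (by linarith)
    rw [Real.norm_eq_abs, abs_mul, abs_mul, abs_inv, abs_of_pos htu, abs_of_pos (hWpos _ _)]
    calc (t - u)⁻¹ * |W (t - u) z - 1| * W u (Φ.flow (t - u) z)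
        ≤ (t - u)⁻¹ * (2 * (|β| * ((t - u) * C))) * Real.exp (|β| * (|u| * C)) :=
          mul_le_mul (mul_le_mul_of_nonneg_left h1 (inv_nonneg.2 htu.le)) (hWle _ _) (hWpos _ _).le
            (by positivity)
      _ = 2 * (|β| * C) * Real.exp (|β| * (|u| * C)) := by
          field_simp
  · filter_upwards [hae] with z hz
    have hfi := fun a b => Φ.intervalIntegrable_comp_flow_of_bounded hz hFm hC a b
    -- (a) the difference quotient of `δ ↦ W_δ(z)` at `0⁺`
    have hd := Φ.hasDerivWithinAt_tilt hFc hC hz β 0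
    rw [Φ.flow_zero z hz, intervalIntegral.integral_same, mul_zero, Real.exp_zero, one_mul] at hd
    simp only [← hW] at hd
    have hs : Tendsto (slope (W · z) 0) (𝓝[>] 0) (𝓝 (β * F z)) :=
      (hasDerivWithinAt_iff_tendsto_slope' (lt_irrefl (0 : ℝ) : (0 : ℝ) ∉ Ioi 0)).1
        (hasDerivWithinAt_Ioi_iff_Ici.2 hd)
    have hW0 : W 0 z = 1 := by rw [hW, intervalIntegral.integral_same, mul_zero, Real.exp_zero]
    have ha : Tendsto (fun t => (t - u)⁻¹ * (W (t - u) z - 1)) (𝓝[>] u) (𝓝 (β * F z)) := by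
      refine (hs.comp (tendsto_sub_nhdsGT u)).congr fun t => ?_
      simp only [Function.comp_apply, slope_def_field, sub_zero, hW0, div_eq_inv_mul]
    -- (b) continuity of the shifted tilt `t ↦ W_u(Φ_{t-u} z) = exp β(∫₀ᵗ − ∫₀^{t−u})`
    obtain ⟨J, hJ⟩ : ∃ J : ℝ → ℝ, ∀ s, J s = ∫ r in (0 : ℝ)..s, F (Φ.flow r z) := ⟨_, fun _ => rfl⟩
    have hJc : Continuous J := by
      rw [show J = fun s => ∫ r in (0 : ℝ)..s, F (Φ.flow r z) from funext hJ]
      exact intervalIntegral.continuous_primitive hfi 0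
    have hshift : ∀ t, W u (Φ.flow (t - u) z) = Real.exp (β * (J t - J (t - u))) := by
      intro t
      have h1 := Φ.intervalIntegral_comp_flow_flow F hz 0 u (t - u)
      rw [zero_add, add_comm, sub_add_cancel] at h1
      rw [hJ, hJ, hW, h1, intervalIntegral.integral_interval_sub_left (hfi 0 t) (hfi 0 (t - u))]
    have hb : Tendsto (fun t => W u (Φ.flow (t - u) z)) (𝓝[>] u) (𝓝 (W u z)) := by
      have hc : Continuous fun t => Real.exp (β * (J t - J (t - u))) := by fun_prop
      have h2 := (hc.tendsto u).mono_left (nhdsWithin_le_nhds (s := Ioi u))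
      rw [sub_self, hJ 0, intervalIntegral.integral_same, sub_zero, hJ u, ← hW] at h2
      simp_rw [hshift]
      exact h2
    simpa only [mul_assoc] using ha.mul hb

end HardSphereFlow

end Literature.Analysis.FluidPDE

end
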